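import Summits.NavierStokesRegularity.NavierStokesRegularity.Theorems.NoOverheating.Negative.ScrewWindowsExcluded
import Literature.Analysis.FluidPDE.PineauVicolRDSSLiouvilleHolds

/-!
# KJ-35b — the SLOW-SCREW and FAST-SCREW strata of the rotations are EXCLUDED in Pineau–Vicol's
# regimes (i)/(ii) from the window sequences of route `AngularGalerkinLadder` (Theorem 1.7)

Refuter lineage, Negative lane of crux K2 `NoOverheating` (supports, does not decide).  The
transport `no_windowSequence_screw_core` (KJ-35a) fed with Pineau–Vicol's rotated-DSS Liouville
theorem (tree theorem `pineauVicol2026_rdss_liouville_holds`): a window sequence whose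
DSS-rotations are screws `Rₙ = gₙ R_{θₙ} gₙ⁻¹` about ANY (varying) axis does not exist when either
(i) it is SLOW, `|θₙ| ≤ 2 α₁(C₀) log cₙ` (speed `|αₙ| ≤ α₁`, `αₙ = θₙ/(2 log cₙ)`), with window top
`cmax < c₁(C₀)`; or (ii) it is FAST, `2 α₂(C₀) log cₙ ≤ |θₙ| ≤ Θ`, and fine relative to its
speed, `(1 + αₙ²) log cₙ ≤ ℓ < log c₂(C₀)`.
* `no_windowSequence_slowScrew` (any axes), `no_windowSequence_slowScrew_rotZ` (axis `e₃`) (§5);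
* `not_cofinal_and_noOverheating_slowScrew`, `rungBlowupCofinal_false_of_noOverheating_slowScrew`
  — the reading on K1 ∧ K2 (§6): on stratum (i) a K2 must let its window reach `c₁(C₀)` or its
  profiles twist faster than `2 α₁ log c` per period.  For `θₙ = 0` this is KJ-33's
  `no_windowSequence_fineRatio` with the axis data explicit (Chae–Wolf's `λ₁` replaced by `c₁`);
* `no_windowSequence_fastScrew`, `not_cofinal_and_noOverheating_fastScrew` — regime (ii) (§7).
WHAT ESCAPES: proper rotations in Pineau–Vicol's open middle range `α₁ < |α| < α₂`, fast screws
with `c ≥ c₂^{1/(1+α²)}`, improper `R`, coarse windows `cmax ≥ c₁`.  WHAT THIS IS NOT: not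
`¬NoOverheating`, no new Literature fact, no definition, standard axioms only.
[cite: PineauVicol2026, Theorem 1.7 (i)–(ii) (arXiv:2607.09619 p. 7)]
[cite: ChaeWolf2017RemovingDSS, Theorem 1.3 / Remark 1.4] [cite: BradshawTsai2017CPDE, §1] -/

namespace Summit.NavierStokesRegularity.AngularGalerkinLadderSlowScrewWindowsExcluded

open Set Filter MeasureTheory Topology Function
open Literature.Analysis Literature.Analysis.FluidPDE
open Summit.NavierStokesRegularity.FluidComputer
open Summit.NavierStokesRegularity.NavierStokesRegularity.Theses.AngularGalerkinLadder
open Summit.NavierStokesRegularity.AngularGalerkinLadderFineRatioWindowsExcluded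
open Summit.NavierStokesRegularity.AngularGalerkinLadderScrewWindowsExcluded

/-! ### §5 The slow-screw stratum below Pineau–Vicol's thresholds is empty -/

/-- **No admissible window sequence of SLOW SCREWS below Pineau–Vicol's thresholds.**  For every
`C₀` there are `α₁ > 0` and `c₁ > 1` (Pineau–Vicol 2026, Thm 1.7 (i), depending on `C₀` only) such
that: constants `1 < cmin`, `0 < δ`, `εₙ → 0`, a window rung profile with constant `C₀` and window
`[cmin, cmax]` at every index whose DSS-rotation is a rotation `Rₙ = gₙ R_{θₙ} gₙ⁻¹` about an
arbitrary (varying) axis by an angle `|θₙ| ≤ 2 α₁ log cₙ` (speed `|αₙ| ≤ α₁` in (1.13)), and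
`cmax < c₁`, are contradictory; `C₀ ≤ 0` is vacuous by the amplitude floor.
[cite: PineauVicol2026, Theorem 1.7 (i) (arXiv:2607.09619 p. 7)] -/
theorem no_windowSequence_slowScrew (C₀ : ℝ) :
    ∃ α₁ : ℝ, 0 < α₁ ∧ ∃ c₁ : ℝ, 1 < c₁ ∧ ∀ {cmin cmax δ : ℝ} {L : ℕ → ℕ} {ε c θ : ℕ → ℝ}
      {R g : ℕ → (EuclideanSpace ℝ (Fin 3) ≃ₗᵢ[ℝ] EuclideanSpace ℝ (Fin 3))}
      {u : ℕ → ℝ → EuclideanSpace ℝ (Fin 3) → EuclideanSpace ℝ (Fin 3)}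
      {p : ℕ → ℝ → EuclideanSpace ℝ (Fin 3) → ℝ}
      {d : ℕ → ℝ → EuclideanSpace ℝ (Fin 3) → EuclideanSpace ℝ (Fin 3)},
      cmax < c₁ → 1 < cmin → 0 < δ → Tendsto ε atTop (𝓝 0) →
      (∀ n, AngularLadder.IsWindowProfile (L n) C₀ cmin cmax δ (ε n) (c n) (R n) (u n) (p n)
        (d n)) →
      (∀ n x, R n x = g n (rotZ (θ n) ((g n).symm x))) →
      (∀ n, |θ n| ≤ 2 * α₁ * Real.log (c n)) → False := by
  by_cases hC₀ : 0 < C₀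
  · obtain ⟨α₁, c₁, hα₁, hc₁, PV⟩ := (pineauVicol2026_rdss_liouville_holds C₀ hC₀).1
    refine ⟨α₁, hα₁, c₁, hc₁,
      fun {cmin cmax δ L ε c θ R g u p d} hcmax hcmin hδ hε hW hconj hθ => ?_⟩
    have hcpos : ∀ n, 0 < c n := fun n => (one_pos.trans hcmin).trans_le (hW n).2.1
    refine no_windowSequence_screw_core
      (fun θ' c' => |(-θ') / (2 * Real.log c')| ≤ α₁ ∧ c' < c₁)
      (fun θ' c' hq hc' w P U hcl hTI hU hper hans =>
        PV _ c' w P U hq.1 hc' hq.2 hcl hTI hU hper hans)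
      (B := 2 * α₁ * Real.log cmax) hcmin hδ hε hW hconj (fun n => (hθ n).trans
        (mul_le_mul_of_nonneg_left (Real.log_le_log (hcpos n) (hW n).2.2.1) (by positivity)))
      fun κ θ' c' hκ hθlim hclim => ?_
    have hc'ge : cmin ≤ c' := ge_of_tendsto' hclim fun n => (hW (κ n)).2.1
    have hc'le : c' ≤ cmax := le_of_tendsto' hclim fun n => (hW (κ n)).2.2.1
    have hc' : 1 < c' := hcmin.trans_le hc'ge
    have hθ' : |θ'| ≤ 2 * α₁ * Real.log c' := by
      have h1 : Tendsto (fun n => |θ (κ n)|) atTop (𝓝 |θ'|) := hθlim.abs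
      have h2 : Tendsto (fun n => 2 * α₁ * Real.log (c (κ n))) atTop
          (𝓝 (2 * α₁ * Real.log c')) :=
        ((Real.continuousAt_log (one_pos.trans hc').ne').tendsto.comp hclim).const_mul _
      exact le_of_tendsto_of_tendsto' h1 h2 fun n => hθ _
    refine ⟨?_, lt_of_le_of_lt hc'le hcmax⟩
    have hlogc : 0 < Real.log c' := Real.log_pos hc'
    rw [abs_div, abs_neg, abs_of_pos (by positivity : (0 : ℝ) < 2 * Real.log c'),
      div_le_iff₀ (by positivity)]
    linarith
  · refine ⟨1, one_pos, 2, one_lt_two, fun {cmin cmax δ L ε c θ R g u p d} _ _ hδ _ hW _ _ => ?_⟩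
    exact hC₀ (typeI_const_pos_of_window hδ (hW 0))

/-- **Slow screws about the FIXED axis `e₃`** (`Rₙ = R_{θₙ}`, `|θₙ| ≤ 2 α₁ log cₙ`, `cmax < c₁`): no
admissible window sequence. [cite: PineauVicol2026, Theorem 1.7 (i) (arXiv:2607.09619 p. 7)] -/
theorem no_windowSequence_slowScrew_rotZ (C₀ : ℝ) :
    ∃ α₁ : ℝ, 0 < α₁ ∧ ∃ c₁ : ℝ, 1 < c₁ ∧ ∀ {cmin cmax δ : ℝ} {L : ℕ → ℕ} {ε c θ : ℕ → ℝ}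
      {R : ℕ → (EuclideanSpace ℝ (Fin 3) ≃ₗᵢ[ℝ] EuclideanSpace ℝ (Fin 3))}
      {u : ℕ → ℝ → EuclideanSpace ℝ (Fin 3) → EuclideanSpace ℝ (Fin 3)}
      {p : ℕ → ℝ → EuclideanSpace ℝ (Fin 3) → ℝ}
      {d : ℕ → ℝ → EuclideanSpace ℝ (Fin 3) → EuclideanSpace ℝ (Fin 3)},
      cmax < c₁ → 1 < cmin → 0 < δ → Tendsto ε atTop (𝓝 0) →
      (∀ n, AngularLadder.IsWindowProfile (L n) C₀ cmin cmax δ (ε n) (c n) (R n) (u n) (p n)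
        (d n)) →
      (∀ n, R n = rotZLIE (θ n)) → (∀ n, |θ n| ≤ 2 * α₁ * Real.log (c n)) → False := by
  obtain ⟨α₁, hα₁, c₁, hc₁, H⟩ := no_windowSequence_slowScrew C₀
  refine ⟨α₁, hα₁, c₁, hc₁, fun {cmin cmax δ L ε c θ R u p d} hcmax hcmin hδ hε hW hR hθ => ?_⟩
  exact H (g := fun _ => LinearIsometryEquiv.refl ℝ (EuclideanSpace ℝ (Fin 3))) hcmax hcmin hδ hε hW
    (fun n x => by rw [hR n]; rfl) hθ

/-! ### §6 Read on the open cruxes -/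

/-- **K1 ∧ (K2 on the slow-screw stratum below Pineau–Vicol's thresholds) is FALSE**: for every
`C₀` there are `α₁ > 0`, `c₁ > 1` such that `RungBlowupCofinal` and a `NoOverheating` with constant
`C₀`, window top `cmax < c₁` and window profiles whose DSS-rotation is a rotation by an angle
`|θ| ≤ 2 α₁ log c` about some axis are contradictory. [cite: PineauVicol2026, Theorem 1.7 (i)] -/
theorem not_cofinal_and_noOverheating_slowScrew (C₀ : ℝ) :
    ∃ α₁ : ℝ, 0 < α₁ ∧ ∃ c₁ : ℝ, 1 < c₁ ∧ ¬ (RungBlowupCofinal ∧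
      ∃ (cmin cmax δ : ℝ) (L₀ : ℕ) (ε : ℕ → ℝ), cmax < c₁ ∧ 1 < cmin ∧ 0 < δ ∧
        Tendsto ε atTop (𝓝 0) ∧
        ∀ L ≥ L₀, AngularLadder.RungIsSingular L →
          ∃ (c : ℝ) (R : EuclideanSpace ℝ (Fin 3) ≃ₗᵢ[ℝ] EuclideanSpace ℝ (Fin 3))
            (u : ℝ → EuclideanSpace ℝ (Fin 3) → EuclideanSpace ℝ (Fin 3))
            (p : ℝ → EuclideanSpace ℝ (Fin 3) → ℝ)
            (d : ℝ → EuclideanSpace ℝ (Fin 3) → EuclideanSpace ℝ (Fin 3))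
            (g : EuclideanSpace ℝ (Fin 3) ≃ₗᵢ[ℝ] EuclideanSpace ℝ (Fin 3)) (θ : ℝ),
            AngularLadder.IsWindowProfile L C₀ cmin cmax δ (ε L) c R u p d ∧
              (∀ x, R x = g (rotZ θ (g.symm x))) ∧ |θ| ≤ 2 * α₁ * Real.log c) := by
  obtain ⟨α₁, hα₁, c₁, hc₁, H⟩ := no_windowSequence_slowScrew C₀
  refine ⟨α₁, hα₁, c₁, hc₁, ?_⟩
  rintro ⟨h₁, cmin, cmax, δ, L₀, ε, hcmax, hcmin, hδ, hε, hwin⟩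
  choose L hLge hLsing using fun n : ℕ => h₁ (max L₀ n)
  choose c R u p d g θ hW hconj hθ using fun n : ℕ =>
    hwin (L n) (le_trans (le_max_left _ _) (hLge n)) (hLsing n)
  have hε' : Tendsto (fun n : ℕ => ε (L n)) atTop (𝓝 0) :=
    hε.comp (tendsto_atTop_mono (fun n => le_trans (le_max_right _ _) (hLge n)) tendsto_id)
  exact H hcmax hcmin hδ hε' hW hconj hθ

/-- Census edge on K1: a `NoOverheating` met on the slow-screw stratum, `cmax < c₁(C₀)`, refutes
`RungBlowupCofinal`. [cite: PineauVicol2026, Theorem 1.7 (i)] -/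
theorem rungBlowupCofinal_false_of_noOverheating_slowScrew (C₀ : ℝ) :
    ∃ α₁ : ℝ, 0 < α₁ ∧ ∃ c₁ : ℝ, 1 < c₁ ∧ ∀ {cmin cmax δ : ℝ} {L₀ : ℕ} {ε : ℕ → ℝ},
      cmax < c₁ → 1 < cmin → 0 < δ → Tendsto ε atTop (𝓝 0) →
      (∀ L ≥ L₀, AngularLadder.RungIsSingular L →
        ∃ (c : ℝ) (R : EuclideanSpace ℝ (Fin 3) ≃ₗᵢ[ℝ] EuclideanSpace ℝ (Fin 3))
          (u : ℝ → EuclideanSpace ℝ (Fin 3) → EuclideanSpace ℝ (Fin 3))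
          (p : ℝ → EuclideanSpace ℝ (Fin 3) → ℝ)
          (d : ℝ → EuclideanSpace ℝ (Fin 3) → EuclideanSpace ℝ (Fin 3))
          (g : EuclideanSpace ℝ (Fin 3) ≃ₗᵢ[ℝ] EuclideanSpace ℝ (Fin 3)) (θ : ℝ),
          AngularLadder.IsWindowProfile L C₀ cmin cmax δ (ε L) c R u p d ∧
            (∀ x, R x = g (rotZ θ (g.symm x))) ∧ |θ| ≤ 2 * α₁ * Real.log c) →
      ¬ RungBlowupCofinal := by
  obtain ⟨α₁, hα₁, c₁, hc₁, H⟩ := not_cofinal_and_noOverheating_slowScrew C₀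
  exact ⟨α₁, hα₁, c₁, hc₁, fun {cmin cmax δ L₀ ε} hcmax hcmin hδ hε hwin h₁ =>
    H ⟨h₁, cmin, cmax, δ, L₀, ε, hcmax, hcmin, hδ, hε, hwin⟩⟩

/-! ### §7 The fast-screw stratum in Pineau–Vicol's regime (ii) is empty -/

/-- **No admissible window sequence of FAST SCREWS in Pineau–Vicol's regime (ii).**  For every `C₀`
there are `α₂ > 0` and `c₂ > 1` (Pineau–Vicol 2026, Thm 1.7 (ii), depending on `C₀` only) such
that: constants `1 < cmin`, `0 < δ`, `εₙ → 0`, a window rung profile with constant `C₀` at every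
index whose DSS-rotation is a screw `Rₙ = gₙ R_{θₙ} gₙ⁻¹` (any axis) with bounded angles
`|θₙ| ≤ Θ`, FAST in the sense `2 α₂ log cₙ ≤ |θₙ|` (speed `|αₙ| ≥ α₂`, `αₙ = θₙ/(2 log cₙ)`), and
fine relative to the speed, `(1 + αₙ²) log cₙ ≤ ℓ < log c₂` (i.e. `cₙ ≤ e^ℓ… < c₂^{1/(1+αₙ²)}`
uniformly), are contradictory; `C₀ ≤ 0` is vacuous.  (All three constraints are closed, so they
hold at the limit screw, where Theorem 1.7 (ii) applies via `no_windowSequence_screw_core`.)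
[cite: PineauVicol2026, Theorem 1.7 (ii) (arXiv:2607.09619 p. 7)] -/
theorem no_windowSequence_fastScrew (C₀ : ℝ) :
    ∃ α₂ : ℝ, 0 < α₂ ∧ ∃ c₂ : ℝ, 1 < c₂ ∧ ∀ {cmin cmax δ Θ ℓ : ℝ} {L : ℕ → ℕ} {ε c θ : ℕ → ℝ}
      {R g : ℕ → (EuclideanSpace ℝ (Fin 3) ≃ₗᵢ[ℝ] EuclideanSpace ℝ (Fin 3))}
      {u : ℕ → ℝ → EuclideanSpace ℝ (Fin 3) → EuclideanSpace ℝ (Fin 3)}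
      {p : ℕ → ℝ → EuclideanSpace ℝ (Fin 3) → ℝ}
      {d : ℕ → ℝ → EuclideanSpace ℝ (Fin 3) → EuclideanSpace ℝ (Fin 3)},
      ℓ < Real.log c₂ → 1 < cmin → 0 < δ → Tendsto ε atTop (𝓝 0) →
      (∀ n, AngularLadder.IsWindowProfile (L n) C₀ cmin cmax δ (ε n) (c n) (R n) (u n) (p n)
        (d n)) →
      (∀ n x, R n x = g n (rotZ (θ n) ((g n).symm x))) → (∀ n, |θ n| ≤ Θ) →
      (∀ n, 2 * α₂ * Real.log (c n) ≤ |θ n|) →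
      (∀ n, (1 + (θ n / (2 * Real.log (c n))) ^ 2) * Real.log (c n) ≤ ℓ) → False := by
  by_cases hC₀ : 0 < C₀
  · obtain ⟨α₂, c₂, hα₂, hc₂, PV⟩ := (pineauVicol2026_rdss_liouville_holds C₀ hC₀).2
    refine ⟨α₂, hα₂, c₂, hc₂,
      fun {cmin cmax δ Θ ℓ L ε c θ R g u p d} hℓ hcmin hδ hε hW hconj hΘ hfast hfine => ?_⟩
    refine no_windowSequence_screw_core
      (fun θ' c' => α₂ ≤ |-θ' / (2 * Real.log c')| ∧
        c' < c₂ ^ (1 / (1 + (-θ' / (2 * Real.log c')) ^ 2)))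
      (fun θ' c' hq hc' w P U hcl hTI hU hper hans =>
        PV _ c' w P U hq.1 hc' hq.2 hcl hTI hU hper hans)
      hcmin hδ hε hW hconj hΘ fun κ θ' c' _ hθlim hclim => ?_
    have hc' : 1 < c' := hcmin.trans_le (ge_of_tendsto' hclim fun n => (hW (κ n)).2.1)
    have hlogc : 0 < Real.log c' := Real.log_pos hc'
    have hlog : Tendsto (fun n => Real.log (c (κ n))) atTop (𝓝 (Real.log c')) :=
      (Real.continuousAt_log (one_pos.trans hc').ne').tendsto.comp hclim
    have hα : Tendsto (fun n => θ (κ n) / (2 * Real.log (c (κ n)))) atTop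
        (𝓝 (θ' / (2 * Real.log c'))) :=
      hθlim.div (hlog.const_mul 2) (mul_pos two_pos hlogc).ne'
    -- the speed floor passes to the limit
    have h1 : 2 * α₂ * Real.log c' ≤ |θ'| :=
      le_of_tendsto_of_tendsto' (hlog.const_mul (2 * α₂)) hθlim.abs fun n => hfast (κ n)
    -- the relative fineness passes to the limit
    have h3 : (1 + (θ' / (2 * Real.log c')) ^ 2) * Real.log c' ≤ ℓ :=
      le_of_tendsto' (((hα.pow 2).const_add 1).mul hlog) fun n => hfine (κ n)
    have hsq : (-θ' / (2 * Real.log c')) ^ 2 = (θ' / (2 * Real.log c')) ^ 2 := by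
      rw [neg_div, neg_sq]
    refine ⟨?_, ?_⟩
    · rw [abs_div, abs_neg, abs_of_pos (mul_pos two_pos hlogc), le_div_iff₀ (mul_pos two_pos hlogc)]
      linarith
    · rw [hsq]
      have hA : 0 < 1 + (θ' / (2 * Real.log c')) ^ 2 := by positivity
      have hc₂pos : 0 < c₂ := one_pos.trans hc₂
      refine (Real.log_lt_log_iff (one_pos.trans hc') (Real.rpow_pos_of_pos hc₂pos _)).1 ?_
      rw [Real.log_rpow hc₂pos, one_div_mul_eq_div, lt_div_iff₀ hA, mul_comm]
      exact h3.trans_lt hℓ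
  · refine ⟨1, one_pos, 2, one_lt_two,
      fun {cmin cmax δ Θ ℓ L ε c θ R g u p d} _ _ hδ _ hW _ _ _ _ => ?_⟩
    exact hC₀ (typeI_const_pos_of_window hδ (hW 0))

/-- **K1 ∧ (K2 on the fast-screw stratum of regime (ii)) is FALSE**: for every `C₀` there are
`α₂ > 0`, `c₂ > 1` such that `RungBlowupCofinal` and a `NoOverheating` with constant `C₀` whose
window profiles are screws of bounded angle `|θ| ≤ Θ`, speed floor `2 α₂ log c ≤ |θ|` and relative
fineness `(1 + (θ/(2 log c))²) log c ≤ ℓ < log c₂` are contradictory.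
[cite: PineauVicol2026, Theorem 1.7 (ii)] -/
theorem not_cofinal_and_noOverheating_fastScrew (C₀ : ℝ) :
    ∃ α₂ : ℝ, 0 < α₂ ∧ ∃ c₂ : ℝ, 1 < c₂ ∧ ¬ (RungBlowupCofinal ∧
      ∃ (cmin cmax δ Θ ℓ : ℝ) (L₀ : ℕ) (ε : ℕ → ℝ), ℓ < Real.log c₂ ∧ 1 < cmin ∧ 0 < δ ∧
        Tendsto ε atTop (𝓝 0) ∧
        ∀ L ≥ L₀, AngularLadder.RungIsSingular L →
          ∃ (c : ℝ) (R : EuclideanSpace ℝ (Fin 3) ≃ₗᵢ[ℝ] EuclideanSpace ℝ (Fin 3))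
            (u : ℝ → EuclideanSpace ℝ (Fin 3) → EuclideanSpace ℝ (Fin 3))
            (p : ℝ → EuclideanSpace ℝ (Fin 3) → ℝ)
            (d : ℝ → EuclideanSpace ℝ (Fin 3) → EuclideanSpace ℝ (Fin 3))
            (g : EuclideanSpace ℝ (Fin 3) ≃ₗᵢ[ℝ] EuclideanSpace ℝ (Fin 3)) (θ : ℝ),
            AngularLadder.IsWindowProfile L C₀ cmin cmax δ (ε L) c R u p d ∧
              (∀ x, R x = g (rotZ θ (g.symm x))) ∧ |θ| ≤ Θ ∧ 2 * α₂ * Real.log c ≤ |θ| ∧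
              (1 + (θ / (2 * Real.log c)) ^ 2) * Real.log c ≤ ℓ) := by
  obtain ⟨α₂, hα₂, c₂, hc₂, H⟩ := no_windowSequence_fastScrew C₀
  refine ⟨α₂, hα₂, c₂, hc₂, ?_⟩
  rintro ⟨h₁, cmin, cmax, δ, Θ, ℓ, L₀, ε, hℓ, hcmin, hδ, hε, hwin⟩
  choose L hLge hLsing using fun n : ℕ => h₁ (max L₀ n)
  choose c R u p d g θ hW hconj hΘ hfast hfine using fun n : ℕ =>
    hwin (L n) (le_trans (le_max_left _ _) (hLge n)) (hLsing n)
  have hε' : Tendsto (fun n : ℕ => ε (L n)) atTop (𝓝 0) :=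
    hε.comp (tendsto_atTop_mono (fun n => le_trans (le_max_right _ _) (hLge n)) tendsto_id)
  exact H hℓ hcmin hδ hε' hW hconj hΘ hfast hfine

end Summit.NavierStokesRegularity.AngularGalerkinLadderSlowScrewWindowsExcluded
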